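import Mathlib.Data.Real.Basic
import Literature.Computability.MetaComplexity.PolynomialCalculusCNF
import Literature.Computability.MetaComplexity.PolynomialCalculusResidueProperties
import HarnessLib

/-!
# Respectful boundary expanders (Mikša–Nordström 2015, §3.1) and their support closure

The combinatorial half of Mikša–Nordström's GENERALISED ALEKHNOVICH–RAZBOROV METHOD for
polynomial-calculus degree lower bounds (CCC 2015 / arXiv:1505.01358, §3; JACM 2024).  A CNF is
presented as `⋀_{i} 𝓕 i ∧ E` with SUBFORMULAS `𝓕 : ι → CNF ℕ` (left vertices), a family of VARIABLE
SETS `𝒱 : κ → Finset ℕ` (right vertices, possibly overlapping) and FIXED CONSTRAINTS `E`: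

* `Touches`, `PSat`, `Respects`, `toRestr` — a partial assignment on a variable set `V` touching /
  satisfying a clause, RESPECTING `E` (MN15 Def. 3.1: every touched clause of `E` is satisfied);
* `IsNbr` (`𝓕 i` and `𝒱 k` share a variable), `IsRespNbr` (MN15 Def. 3.2/3.3: moreover some
  assignment to `𝒱 k` satisfies all of `𝓕 i` and respects `E`), `respBoundary S` (Def. 3.4 =
  arXiv Def. 8, the respectful boundary `∂ʳ(S)`: the variable sets `𝒱 k` that are a respectful
  neighbour of some `i ∈ S` and a neighbour of no other member of `S`), `IsRespExpander s δ ξ`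
  (Def. 3.5 = arXiv Def. 9: `|S| ≤ s ⇒ |∂ʳ(S)| ≥ δ|S| - ξ`);
* `nbrs S` (all neighbours of `S`), `locSol S` (common Boolean roots of `⋀_{i ∈ S} 𝓕 i ∧ E`) and
  the override lemma `ovr_toRestr_mem_locSol` (a respectful assignment on `𝒱 k` maps roots of
  `𝓕_J ∧ E` to roots of `𝓕_I ∧ E` when it satisfies the `𝓕 i`, `i ∈ I ∖ J`, and touches no other
  member of `I`) — the engine of MN15 Lemmas 3.9/3.10 (arXiv Lemmas 27/28);
* the SUPPORT CLOSURE `msupp s U ⊆ ι` of a set `U ⊆ κ` of variable sets.  MN15 (after Filmus) take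
  the union of all `S` with `|S| ≤ s` and `∂ʳ(S) ⊆ U`; we use instead the Galesi–Lauria-style LEAST
  `U`-CLOSED SET (`IsEscape`, `IsClosedFor`: no `B` with `|B| ≤ s/2` all of whose respectful
  boundary sets inside `S ∪ B` lie in `U` stays outside `S`), which serves the same three purposes
  with the same expansion computation — `two_mul_card_msupp_le` (MN15 Lemmas 3.7/3.8 = arXiv 25/26:
  `|U| ≤ δs/2 - ξ ⇒ |Sup(U)| ≤ s/2`), `exists_escape` (the escaping boundary set used in Lemma 27)
  and `msupp_union_nbrs` (`Sup(U ∪ N(Sup U)) = Sup(U)`, replacing the degree comparison of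
  Lemma 31) — and avoids any degree-compatibility requirement on the monomial order (so the colex
  residues of `PolynomialCalculusResidue*.lean` apply verbatim).

Source: M. Mikša, J. Nordström, *A generalized method for proving polynomial calculus degree lower
bounds*, CCC 2015 (LIPIcs 33) §3 = arXiv:1505.01358 §3 (Defs. 4–10, Thm 11, Lemmas 25–29)
[MiksaNordstrom2015] (held copy `paper:arxiv-1505.01358`); N. Galesi, M. Lauria, ACM ToCL 2010,
Def. 2 (the closure) [GalesiLauria2010].  The degree lower bound itself (MN15 Thm 3.6 = arXiv
Thm 11) is `PolynomialCalculusRespectfulExpanderDegree.lean`.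
-/

noncomputable section

namespace Literature.Computability.MetaComplexity

namespace MiksaNordstrom

open Finset MvPolynomial Literature.Computability.Complexity PCResidue

/-! ### Partial assignments on a variable set -/

/-- The variable set `V` TOUCHES the clause `C` (they share a variable). [Mikša–Nordström 2015,
Def. 3.1] [cite: MiksaNordstrom2015, Definition 3.1] -/
def Touches (V : Finset ℕ) (C : Clause ℕ) : Prop := ∃ l ∈ C, l.1 ∈ V

/-- The partial assignment `a|_V` SATISFIES the clause `C`: some literal of `C` on a variable of
`V` is made true. [Mikša–Nordström 2015, Def. 3.1] [cite: MiksaNordstrom2015, Definition 3.1] -/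
def PSat (V : Finset ℕ) (a : ℕ → Bool) (C : Clause ℕ) : Prop := ∃ l ∈ C, l.1 ∈ V ∧ a l.1 = l.2

/-- `a|_V` RESPECTS `E`: every clause of `E` it touches, it satisfies ("`α` is an autarky for
`E`"). [Mikša–Nordström 2015, Def. 3.1] [cite: MiksaNordstrom2015, Definition 3.1] -/
def Respects (V : Finset ℕ) (a : ℕ → Bool) (E : CNF ℕ) : Prop :=
  ∀ C ∈ E, Touches V C → PSat V a C

/-- The partial assignment `a|_V` as a `0/1` restriction. [Mikša–Nordström 2015, §2 (restrictions)]
[cite: MiksaNordstrom2015, §2] -/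
def toRestr (V : Finset ℕ) (a : ℕ → Bool) : ℕ → Option Bool :=
  fun j => if j ∈ V then some (a j) else none

/-- `toRestr` outside `V` ("leaves unassigned all other variables"). [Mikša–Nordström 2015, §2
(restrictions)] [cite: MiksaNordstrom2015, §2] -/
theorem toRestr_of_notMem {V : Finset ℕ} (a : ℕ → Bool) {j : ℕ} (h : j ∉ V) :
    toRestr V a j = none := if_neg h

/-- `toRestr` on `V`. [Mikša–Nordström 2015, §2 (restrictions)] [cite: MiksaNordstrom2015, §2] -/
theorem toRestr_of_mem {V : Finset ℕ} (a : ℕ → Bool) {j : ℕ} (h : j ∈ V) :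
    toRestr V a j = some (a j) := if_pos h

/-- A clause satisfied by `a|_V` is satisfied by every override with `a|_V` ("`α` satisfies all
clauses … which it touches", the restricted clause disappears). [Mikša–Nordström 2015, §2
(restrictions), Def. 3.1] [cite: MiksaNordstrom2015, §2] -/
theorem eval_ovr_of_pSat {V : Finset ℕ} {a : ℕ → Bool} {C : Clause ℕ} (h : PSat V a C)
    (x : ℕ → Bool) : C.eval (ovr (toRestr V a) x) = true := by
  obtain ⟨l, hl, hlV, hal⟩ := h
  simp only [Clause.eval, List.any_eq_true]
  refine ⟨l, hl, ?_⟩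
  rw [Literal.eval, ovr_of_some (toRestr_of_mem a hlV), hal]
  simp

/-- An untouched clause keeps its value under the override ("`F↾α ⊆ F` after we remove all
satisfied clauses"). [Mikša–Nordström 2015, §2 (restrictions), Def. 3.1] [cite: MiksaNordstrom2015, §2] -/
theorem eval_ovr_of_not_touches {V : Finset ℕ} (a : ℕ → Bool) {C : Clause ℕ} (h : ¬ Touches V C)
    (x : ℕ → Bool) : C.eval (ovr (toRestr V a) x) = C.eval x := by
  have key : ∀ l ∈ C, Literal.eval (ovr (toRestr V a) x) l = Literal.eval x l := fun l hl => by
    have hlV : l.1 ∉ V := fun hlV => h ⟨l, hl, hlV⟩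
    rw [Literal.eval, Literal.eval, ovr_of_none (toRestr_of_notMem a hlV)]
  rw [Bool.eq_iff_iff]
  simp only [Clause.eval, List.any_eq_true]
  exact ⟨fun ⟨l, hl, hv⟩ => ⟨l, hl, (key l hl) ▸ hv⟩, fun ⟨l, hl, hv⟩ => ⟨l, hl, (key l hl).symm ▸ hv⟩⟩

/-! ### The structure `(𝓕, 𝒱)_E` -/

variable {ι κ : Type*} (𝓕 : ι → CNF ℕ) (𝒱 : κ → Finset ℕ) (E : CNF ℕ)

/-- `𝓕 i` and `𝒱 k` are NEIGHBOURS: they share a variable. [Mikša–Nordström 2015, Def. 3.2]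
[cite: MiksaNordstrom2015, Definition 3.2] -/
def IsNbr (i : ι) (k : κ) : Prop := ∃ C ∈ 𝓕 i, Touches (𝒱 k) C

/-- `𝒱 k` is a RESPECTFUL neighbour of `𝓕 i`: a neighbour, and some assignment to `𝒱 k` satisfies
every clause of `𝓕 i` while respecting `E`. [Mikša–Nordström 2015, Defs. 3.2–3.3]
[cite: MiksaNordstrom2015, Definition 3.3] -/
def IsRespNbr (i : ι) (k : κ) : Prop :=
  IsNbr 𝓕 𝒱 i k ∧ ∃ a : ℕ → Bool, (∀ C ∈ 𝓕 i, PSat (𝒱 k) a C) ∧ Respects (𝒱 k) a E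

/-- The common Boolean roots of `⋀_{i ∈ S} 𝓕 i ∧ E` (the zero set of the ideal `⟨S ∧ E⟩` of MN15
arXiv:1505.01358 Def. 23 (p. 13), by multilinear completeness; the held copy is the arXiv version,
whose numbering is used as the checkable locator). [Mikša–Nordström 2015, §3.3 (arXiv Def. 23)]
[cite: MiksaNordstrom2015, §3.3] -/
def locSol (S : Finset ι) : Set (ℕ → Bool) :=
  {x | (∀ C ∈ E, C.eval x = true) ∧ ∀ i ∈ S, ∀ C ∈ 𝓕 i, C.eval x = true}

variable {𝓕 𝒱 E}

/-- Fewer subformulas, more common roots ("Removing axioms … only relaxes the conditions on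
satisfiability"). [Mikša–Nordström 2015, proof of Thm 3.6 (arXiv Thm 11)] [cite: MiksaNordstrom2015, Theorem 3.6] -/
theorem locSol_mono {S T : Finset ι} (h : S ⊆ T) : locSol 𝓕 E T ⊆ locSol 𝓕 E S :=
  fun _ hx => ⟨hx.1, fun i hi => hx.2 i (h hi)⟩

/-- **The override lemma.** Let `a|_{𝒱 k}` respect `E`, and let every `i ∈ I` either have all its
clauses satisfied by `a|_{𝒱 k}` or be a non-neighbour of `𝒱 k` lying in `J`.  Then overriding a
common root of `𝓕_J ∧ E` by `a|_{𝒱 k}` gives a common root of `𝓕_I ∧ E` ("all axioms in `F` are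
set to `0` … none of the axioms in `𝓕' ∖ {F}` are affected … any axiom in `E` is either satisfied
or left intact"). [Mikša–Nordström 2015, proof of Lemma 3.9 (arXiv Lemma 27) and Lemma 28]
[cite: MiksaNordstrom2015, Lemma 3.9] -/
theorem ovr_toRestr_mem_locSol {I J : Finset ι} {k : κ} {a : ℕ → Bool}
    (hres : Respects (𝒱 k) a E)
    (hI : ∀ i ∈ I, (∀ C ∈ 𝓕 i, PSat (𝒱 k) a C) ∨ (¬ IsNbr 𝓕 𝒱 i k ∧ i ∈ J))
    {x : ℕ → Bool} (hx : x ∈ locSol 𝓕 E J) : ovr (toRestr (𝒱 k) a) x ∈ locSol 𝓕 E I := by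
  refine ⟨fun C hC => ?_, fun i hi C hC => ?_⟩
  · by_cases ht : Touches (𝒱 k) C
    · exact eval_ovr_of_pSat (hres C hC ht) x
    · rw [eval_ovr_of_not_touches a ht]; exact hx.1 C hC
  · rcases hI i hi with h | ⟨hn, hiJ⟩
    · exact eval_ovr_of_pSat (h C hC) x
    · have ht : ¬ Touches (𝒱 k) C := fun ht => hn ⟨C, hC, ht⟩
      rw [eval_ovr_of_not_touches a ht]; exact hx.2 i hiJ C hC

/-! ### Boundaries and neighbourhoods -/

section Boundary

variable [Fintype κ] (𝓕 𝒱 E)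

/-- The RESPECTFUL BOUNDARY `∂ʳ(S)`: the variable sets that are respectful neighbours of some
`i ∈ S` and neighbours of no other member of `S`. [Mikša–Nordström 2015, Def. 3.4]
[cite: MiksaNordstrom2015, Definition 3.4] -/
def respBoundary (S : Finset ι) : Finset κ := by
  classical exact Finset.univ.filter fun k => ∃ i ∈ S, IsRespNbr 𝓕 𝒱 E i k ∧ ∀ i' ∈ S, i' ≠ i → ¬ IsNbr 𝓕 𝒱 i' k

/-- `(s, δ, ξ, E)`-RESPECTFUL BOUNDARY EXPANDER: `|S| ≤ s ⇒ |∂ʳ(S)| ≥ δ|S| - ξ`.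
[Mikša–Nordström 2015, Def. 3.5] [cite: MiksaNordstrom2015, Definition 3.5] -/
def IsRespExpander (s δ ξ : ℝ) : Prop :=
  ∀ S : Finset ι, (S.card : ℝ) ≤ s → δ * S.card - ξ ≤ ((respBoundary 𝓕 𝒱 E S).card : ℝ)

/-- All neighbours `N(S)` of a set of subformulas. [Mikša–Nordström 2015, §3.1]
[cite: MiksaNordstrom2015, Definition 3.2] -/
def nbrs (S : Finset ι) : Finset κ := by
  classical exact Finset.univ.filter fun k => ∃ i ∈ S, IsNbr 𝓕 𝒱 i k

variable {𝓕 𝒱 E}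

/-- Membership in the respectful boundary. [Mikša–Nordström 2015, Def. 3.4]
[cite: MiksaNordstrom2015, Definition 3.4] -/
theorem mem_respBoundary {S : Finset ι} {k : κ} : k ∈ respBoundary 𝓕 𝒱 E S ↔
    ∃ i ∈ S, IsRespNbr 𝓕 𝒱 E i k ∧ ∀ i' ∈ S, i' ≠ i → ¬ IsNbr 𝓕 𝒱 i' k := by
  classical
  simp [respBoundary]

/-- Membership in `N(S)`. [Mikša–Nordström 2015, §3.1] [cite: MiksaNordstrom2015, Definition 3.2] -/
theorem mem_nbrs {S : Finset ι} {k : κ} : k ∈ nbrs 𝓕 𝒱 S ↔ ∃ i ∈ S, IsNbr 𝓕 𝒱 i k := by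
  classical
  simp [nbrs]

/-- `N` is monotone. [Mikša–Nordström 2015, §3.1 (neighbourhoods)] [cite: MiksaNordstrom2015, Definition 3.2] -/
theorem nbrs_mono {S T : Finset ι} (h : S ⊆ T) : nbrs 𝓕 𝒱 S ⊆ nbrs 𝓕 𝒱 T := fun k hk => by
  obtain ⟨i, hi, hik⟩ := mem_nbrs.1 hk
  exact mem_nbrs.2 ⟨i, h hi, hik⟩

end Boundary

/-! ### The support closure (Galesi–Lauria style) -/

variable (𝓕 𝒱 E)

/-- `k` is a `U`-ESCAPE of `T` at `i`: a respectful neighbour of `i ∈ T`, a neighbour of no other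
member of `T`, outside `U` (a respectful boundary set of `T` through which the axioms of `i` can
be satisfied without touching `U`). [Mikša–Nordström 2015, proof of Lemma 3.9; Galesi–Lauria 2010,
Def. 2 / Lemma 4] [cite: MiksaNordstrom2015, Lemma 3.9] -/
def IsEscape (U : Finset κ) (T : Finset ι) (i : ι) (k : κ) : Prop :=
  i ∈ T ∧ IsRespNbr 𝓕 𝒱 E i k ∧ (∀ i' ∈ T, i' ≠ i → ¬ IsNbr 𝓕 𝒱 i' k) ∧ k ∉ U

variable [DecidableEq ι]

/-- `S` is `U`-CLOSED (size parameter `s`): every `B` with `|B| ≤ s/2` having no `U`-escape of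
`S ∪ B` at a member of `B` lies inside `S`. [Galesi–Lauria 2010, Def. 2 (transported to MN15's
structures)] [cite: GalesiLauria2010, Definition 2] -/
def IsClosedFor (s : ℝ) (U : Finset κ) (S : Finset ι) : Prop :=
  ∀ B : Finset ι, 2 * (B.card : ℝ) ≤ s → (∀ i ∈ B, ∀ k, ¬ IsEscape 𝓕 𝒱 E U (S ∪ B) i k) → B ⊆ S

variable [Fintype ι]

/-- **The support `Sup(U)`**: the least `U`-closed set of subformulas. [Mikša–Nordström 2015,
§3.3 = arXiv:1505.01358 Def. 21 (support, p. 12; the arXiv numbering is the checkable locator on the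
held copy); Galesi–Lauria 2010, Def. 2] [cite: MiksaNordstrom2015, §3.3 (arXiv Def. 21)] -/
def msupp (s : ℝ) (U : Finset κ) : Finset ι :=
  by classical exact Finset.univ.filter fun i => ∀ S : Finset ι, IsClosedFor 𝓕 𝒱 E s U S → i ∈ S

variable {𝓕 𝒱 E} {s : ℝ}

/-- Membership in `Sup(U)`. [Mikša–Nordström 2015, §3.3] [cite: MiksaNordstrom2015, §3.3] -/
theorem mem_msupp {U : Finset κ} {i : ι} :
    i ∈ msupp 𝓕 𝒱 E s U ↔ ∀ S : Finset ι, IsClosedFor 𝓕 𝒱 E s U S → i ∈ S := by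
  classical
  simp [msupp]

/-- `Sup(U)` lies inside every `U`-closed set. [Galesi–Lauria 2010, Fact 1] [cite: GalesiLauria2010, Fact 1] -/
theorem msupp_subset_of_isClosedFor {U : Finset κ} {S : Finset ι} (h : IsClosedFor 𝓕 𝒱 E s U S) :
    msupp 𝓕 𝒱 E s U ⊆ S :=
  fun _ hi => mem_msupp.1 hi S h

/-- `Sup(U)` is `U`-closed. [Galesi–Lauria 2010, Fact 1] [cite: GalesiLauria2010, Fact 1] -/
theorem isClosedFor_msupp (U : Finset κ) : IsClosedFor 𝓕 𝒱 E s U (msupp 𝓕 𝒱 E s U) := by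
  intro B hB hno i hi
  refine mem_msupp.2 fun S hS => hS B hB (fun i' hi' k hesc => hno i' hi' k ?_) hi
  obtain ⟨hmem, hresp, huniq, hkU⟩ := hesc
  refine ⟨?_, hresp, fun i'' hi'' hne => huniq i'' ?_ hne, hkU⟩
  · rcases Finset.mem_union.1 hmem with h | h
    · exact Finset.mem_union_right _ hi'
    · exact Finset.mem_union_right _ h
  · rcases Finset.mem_union.1 hi'' with h | h
    · exact Finset.mem_union_left _ (msupp_subset_of_isClosedFor hS h)
    · exact Finset.mem_union_right _ h

/-- `Sup` is monotone in `U`. [Mikša–Nordström 2015, §3.3, arXiv:1505.01358 Obs. 22]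
[cite: MiksaNordstrom2015, §3.3] -/
theorem msupp_mono {U U' : Finset κ} (h : U ⊆ U') : msupp 𝓕 𝒱 E s U ⊆ msupp 𝓕 𝒱 E s U' := by
  refine msupp_subset_of_isClosedFor fun B hB hno => isClosedFor_msupp U' B hB fun i hi k hesc => ?_
  obtain ⟨hmem, hresp, huniq, hkU⟩ := hesc
  exact hno i hi k ⟨hmem, hresp, huniq, fun hk => hkU (h hk)⟩

/-- **Escape lemma**: if `I ⊋ Sup(U)` exceeds `Sup(U)` by at most `s/2` elements, then `I` has a
`U`-escape at some `i ∈ I ∖ Sup(U)` (the boundary set "in the respectful boundary of `𝓕'` but not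
in the neighbourhood of `t`" of MN15 Lemma 3.9). [Mikša–Nordström 2015, proof of Lemma 3.9 (arXiv
Lemma 27); Galesi–Lauria 2010, Lemma 4] [cite: MiksaNordstrom2015, Lemma 3.9] -/
theorem exists_escape {U : Finset κ} {I : Finset ι} (hI : msupp 𝓕 𝒱 E s U ⊆ I)
    (hB : 2 * ((I \ msupp 𝓕 𝒱 E s U).card : ℝ) ≤ s) (hne : ¬ I ⊆ msupp 𝓕 𝒱 E s U) :
    ∃ i ∈ I, i ∉ msupp 𝓕 𝒱 E s U ∧ ∃ k, IsEscape 𝓕 𝒱 E U I i k := by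
  by_contra hcon
  push Not at hcon
  apply hne
  have hsub : I \ msupp 𝓕 𝒱 E s U ⊆ msupp 𝓕 𝒱 E s U := by
    refine isClosedFor_msupp U _ hB fun i hi k hesc => ?_
    rw [Finset.union_sdiff_of_subset hI] at hesc
    rw [Finset.mem_sdiff] at hi
    exact hcon i hi.1 hi.2 k hesc
  intro i hi
  by_contra hiS
  exact hiS (hsub (Finset.mem_sdiff.2 ⟨hi, hiS⟩))

section WithK

variable [Fintype κ]

/-- **Smallness of supports** (MN15 Lemmas 3.7–3.8 = arXiv 25–26): in an `(s, δ, ξ, E)`-respectful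
boundary expander with `δ > 0`, a set `U` of at most `δs/2 - ξ` variable sets has `|Sup(U)| ≤ s/2`.
[Mikša–Nordström 2015, Lemma 3.8; Galesi–Lauria 2010, Lemma 3] [cite: MiksaNordstrom2015, Lemma 3.8] -/
theorem two_mul_card_msupp_le {δ ξ : ℝ} (hexp : IsRespExpander 𝓕 𝒱 E s δ ξ) (hδ : 0 < δ)
    (hs : 0 ≤ s) {U : Finset κ} (hU : (U.card : ℝ) ≤ δ * s / 2 - ξ) :
    2 * ((msupp 𝓕 𝒱 E s U).card : ℝ) ≤ s := by
  classical
  set P : Finset (Finset ι) := Finset.univ.filter fun T =>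
    2 * (T.card : ℝ) ≤ s ∧ respBoundary 𝓕 𝒱 E T ⊆ U with hP
  have hbd0 : respBoundary 𝓕 𝒱 E (∅ : Finset ι) ⊆ U := fun k hk => by
    obtain ⟨i, hi, -⟩ := mem_respBoundary.1 hk
    exact absurd hi (Finset.notMem_empty i)
  have hPne : P.Nonempty := ⟨∅, by simp [hP, hs, hbd0]⟩
  obtain ⟨T, hTP, hTmax⟩ := Finset.exists_max_image P Finset.card hPne
  obtain ⟨hTcard, hTΓ⟩ := (Finset.mem_filter.1 hTP).2
  have hclosed : IsClosedFor 𝓕 𝒱 E s U T := by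
    intro B hB hno
    set T' := T ∪ B with hT'
    have hT'Γ : respBoundary 𝓕 𝒱 E T' ⊆ U := by
      intro k hk
      obtain ⟨i, hi, hresp, huniq⟩ := mem_respBoundary.1 hk
      by_cases hiB : i ∈ B
      · by_contra hkU
        exact hno i hiB k ⟨hi, hresp, huniq, hkU⟩
      · have hiT : i ∈ T := by
          rcases Finset.mem_union.1 hi with h | h
          · exact h
          · exact absurd h hiB
        exact hTΓ (mem_respBoundary.2 ⟨i, hiT, hresp, fun i' hi' hne =>
          huniq i' (Finset.mem_union_left _ hi') hne⟩)
    have hT'le : (T'.card : ℝ) ≤ s := by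
      have h1 : (T'.card : ℝ) ≤ T.card + B.card := by exact_mod_cast Finset.card_union_le T B
      linarith
    have hexpT' := hexp T' hT'le
    have hbd : ((respBoundary 𝓕 𝒱 E T').card : ℝ) ≤ U.card := by
      exact_mod_cast Finset.card_le_card hT'Γ
    have hT'card : 2 * (T'.card : ℝ) ≤ s := by nlinarith
    have hT'P : T' ∈ P := Finset.mem_filter.2 ⟨Finset.mem_univ _, hT'card, hT'Γ⟩
    have hle := hTmax T' hT'P
    have heq : T = T' := Finset.eq_of_subset_of_card_le Finset.subset_union_left hle
    rw [heq]
    exact Finset.subset_union_right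
  have := Finset.card_le_card (msupp_subset_of_isClosedFor hclosed)
  have : ((msupp 𝓕 𝒱 E s U).card : ℝ) ≤ T.card := by exact_mod_cast this
  linarith

variable [DecidableEq κ]

/-- **Idempotence**: `Sup(U ∪ N(Sup U)) = Sup(U)` (what "`Sup(rᵢ) ⊆ Sup(xt)`" needs; replaces the
degree comparison of MN15 Lemma 31). [Galesi–Lauria 2010, proof of Lemma 2 (16)]
[cite: GalesiLauria2010, Lemma 2] -/
theorem msupp_union_nbrs (U : Finset κ) :
    msupp 𝓕 𝒱 E s (U ∪ nbrs 𝓕 𝒱 (msupp 𝓕 𝒱 E s U)) = msupp 𝓕 𝒱 E s U := by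
  refine Finset.Subset.antisymm ?_ (msupp_mono Finset.subset_union_left)
  set S := msupp 𝓕 𝒱 E s U with hS
  refine msupp_subset_of_isClosedFor fun B hB hno => ?_
  -- apply closedness of `S` to `B ∖ S`
  have hB' : 2 * ((B \ S).card : ℝ) ≤ s :=
    le_trans (by exact_mod_cast Nat.mul_le_mul_left 2 (Finset.card_le_card Finset.sdiff_subset)) hB
  have hsub : B \ S ⊆ S := by
    refine isClosedFor_msupp U (B \ S) hB' fun i hi k hesc => ?_
    obtain ⟨hmem, hresp, huniq, hkU⟩ := hesc
    rw [Finset.union_sdiff_self_eq_union] at hmem huniq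
    rw [Finset.mem_sdiff] at hi
    refine hno i hi.1 k ⟨hmem, hresp, huniq, fun hk => ?_⟩
    rcases Finset.mem_union.1 hk with hk | hk
    · exact hkU hk
    · obtain ⟨i', hi'S, hn⟩ := mem_nbrs.1 hk
      have hne : i' ≠ i := fun h => hi.2 (h ▸ hi'S)
      exact huniq i' (Finset.mem_union_left _ hi'S) hne hn
  intro i hi
  by_contra hiS
  have := hsub (Finset.mem_sdiff.2 ⟨hi, hiS⟩)
  exact hiS this

/-- Hence `U' ⊆ U ∪ N(Sup U) ⇒ Sup(U') ⊆ Sup(U)`. [Galesi–Lauria 2010, proof of Lemma 2 (14)–(16)]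
[cite: GalesiLauria2010, Lemma 2] -/
theorem msupp_subset_msupp_of_subset_union {U U' : Finset κ}
    (h : U' ⊆ U ∪ nbrs 𝓕 𝒱 (msupp 𝓕 𝒱 E s U)) : msupp 𝓕 𝒱 E s U' ⊆ msupp 𝓕 𝒱 E s U :=
  (msupp_mono h).trans (msupp_union_nbrs U).subset

end WithK

end MiksaNordstrom

end Literature.Computability.MetaComplexity
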